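import Summits.CriticalPhenomena.CardyFormulaZ2.Theorems.CardyMagicRigidityNestingRigidityNeckNodeProductT
import Summits.CriticalPhenomena.CardyFormulaZ2.Theorems.CardyMagicRigidityNestingRigidityNeckTouchDensityT
import Summits.CriticalPhenomena.CardyFormulaZ2.Theorems.CardyMagicRigidityNestingRigidityNeckCoveringA
import Literature.Probability.Percolation.ReimerLocalFinitary
import Literature.Probability.Percolation.SiteReimer
import HarnessLib

/-!
# Crux `NestingRigidity`, line `pinch-resampling` (v4), stub S11: four-arm node events AND arms of distinct clusters on `𝕋` (Reimer glue, with spatial exemptions)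

Crux `Summit.CriticalPhenomena.CardyFormulaZ2.Theses.CardyMagicRigidity.NestingRigidity` (stmt-CriticalPhenomena-4835),
line `pinch-resampling` v4, stub S11 `stub_neckHookupCoarseT : NeckHookupCoarseT`.  Worker W6c, wave 6: the site-`𝕋` twin of
`…NeckZ2NodeReimer` / `…NeckZ2NodeReimerSpatial` (stub S12, p166266/p168307), the glue (R) between the two probabilistic
primitives of the summation of the `𝔄`-error over the necklace of `tCovering_A_chain` (`…NeckCoveringAChainT`): the product of
cluster-form four-arm events over pairwise disjoint hexagonal annuli (`real_biInter_tFourArmTwoClusters_le_prod_rpow`,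
`…NeckNodeProductT`, given (I4T)) and the van den Berg–Kesten bound for arms of pairwise distinct open clusters
(`real_distinctClustersT_arms_le_prod`, `…NeckTouchDensityT`), by Reimer's inequality for site percolation
(`sitePercolation_reimer`, `SiteReimer.lean`) and the witness criterion `mem_inter_disjointOccurrenceList_of_witnesses`.

* §1 `NeckCoarse.mem_tFourArm_disjointOccurrence_arms` (deterministic core): crossings as in the four-arm events and arms
  of pairwise distinct clusters — each arm, for each node, either in a cluster avoiding the node's two crossing starts
  (cluster exemption) or with annulus disjoint from the node's annulus (spatial exemption) — give
  `ω ∈ (⋂ four-arm events) □ (arm □ arm □ ⋯)`.  Witnesses: the open annulus-clusters of the two crossing starts and the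
  CLOSED sites of the node annuli (a cylinder inside the four-arm events, `localCylinder_subset_tFourArm`) against the open
  tight supports of the arms.
* §2 `real_tFourArm_and_arms_le` (registered anchor): GIVEN (I4T) `FourArmTwoClustersBoundT`, the probability is at most
  `(∏ c (r a / R a)^{1+ε}) · ∏ C (r' i / R' i)^α`; the arm annuli may overlap each other and the node annuli arbitrarily.
-/

noncomputable section

namespace Summit.CriticalPhenomena.CardyFormulaZ2.Cruxes.NestingRigidity.PinchResampling

open MeasureTheory Set Literature.Probability.Percolation Literature.Probability.LatticeModels

namespace NeckCoarse

variable {ω : SiteConfig (Site 2)}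

/-! ## §1 The deterministic core -/

/-- Transfer of an open path to a configuration agreeing with `ω` on the sites reachable from the start. -/
theorem pathIn_open_transfer {ω' : SiteConfig (Site 2)} {A : Set (Site 2)} {u v : Site 2}
    (h : PathIn (tColourGraph ω true) A u v)
    (hK : ∀ z, PathIn (tColourGraph ω true) A u z → (z ∈ ω' ↔ z ∈ ω)) : PathIn (tColourGraph ω' true) A u v := by
  obtain ⟨hu, p⟩ := h
  refine ⟨hu, ?_⟩
  induction p with
  | refl => exact Relation.ReflTransGen.refl
  | @tail b c hub hbc ih =>
    have hb : PathIn (tColourGraph ω true) A u b := ⟨hu, hub⟩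
    have hc : PathIn (tColourGraph ω true) A u c := hb.tail hbc.1 hbc.2
    have hadj := hbc.1
    rw [tColourGraph_true, siteOpenGraph_adj] at hadj
    refine ih.tail ⟨?_, hbc.2⟩
    rw [tColourGraph_true, siteOpenGraph_adj]
    exact ⟨hadj.1, (hK b hb).2 hadj.2.1, (hK c hc).2 hadj.2.2⟩

/-- An open path of `ω'` inside `A` is an open path of `ω`, if every site of `A` open in `ω'` is open in `ω`. -/
theorem pathIn_open_of_subset {ω' : SiteConfig (Site 2)} {A : Set (Site 2)} {u v : Site 2}
    (h : PathIn (tColourGraph ω' true) A u v) (hK : ∀ z ∈ A, z ∈ ω' → z ∈ ω) : PathIn (tColourGraph ω true) A u v := by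
  obtain ⟨hu, p⟩ := h
  refine ⟨hu, ?_⟩
  induction p with
  | refl => exact Relation.ReflTransGen.refl
  | @tail b c hub hbc ih =>
    have hb : b ∈ A := PathIn.right_mem (show PathIn (tColourGraph ω' true) A u b from ⟨hu, hub⟩)
    have hadj := hbc.1
    rw [tColourGraph_true, siteOpenGraph_adj] at hadj
    refine ih.tail ⟨?_, hbc.2⟩
    rw [tColourGraph_true, siteOpenGraph_adj]
    exact ⟨hadj.1, hK b hb hadj.2.1, hK c hbc.2 hadj.2.2⟩

/-- **A cylinder inside the four-arm event**: if `ω` carries two open crossings of `tAnn w r R` whose starts are not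
joined by an open path of the annulus, then every configuration agreeing with `ω` on the open annulus-clusters of the two
starts and on the closed sites of the annulus lies in `TFourArmTwoClusters w r R`. -/
theorem localCylinder_subset_tFourArm {w : Site 2} {r R : ℕ} {p₁ q₁ p₂ q₂ : Site 2}
    (hp₁ : triNorm (p₁ - w) = r) (hq₁ : triNorm (q₁ - w) = R) (hp₂ : triNorm (p₂ - w) = r) (hq₂ : triNorm (q₂ - w) = R)
    (h₁ : PathIn (tColourGraph ω true) (tAnn w r R) p₁ q₁) (h₂ : PathIn (tColourGraph ω true) (tAnn w r R) p₂ q₂)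
    (hn : ¬ PathIn (tColourGraph ω true) (tAnn w r R) p₁ p₂) :
    localCylinder ({z | PathIn (tColourGraph ω true) (tAnn w r R) p₁ z} ∪
        {z | PathIn (tColourGraph ω true) (tAnn w r R) p₂ z} ∪ (tAnn w r R \ ω)) ω ⊆ TFourArmTwoClusters w r R := by
  intro ω' hω'
  refine ⟨p₁, q₁, p₂, q₂, hp₁, hq₁, hp₂, hq₂,
    pathIn_open_transfer h₁ fun z hz ↦ hω' z (Or.inl (Or.inl hz)),
    pathIn_open_transfer h₂ fun z hz ↦ hω' z (Or.inl (Or.inr hz)), fun h12 ↦ hn ?_⟩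
  refine pathIn_open_of_subset h12 fun z hz hzω' ↦ ?_
  by_contra hzω
  exact hzω ((hω' z (Or.inr ⟨hz, hzω⟩)).1 hzω')

/-- **Disjoint occurrence of the four-arm events and the arm events, with spatial exemptions** (deterministic core of
`real_tFourArm_and_arms_le`): crossings of the annuli as in the four-arm events and arms of pairwise distinct open
clusters, each arm either avoiding the crossings' starts of a node or having its annulus disjoint from the node's annulus,
give `ω ∈ (⋂ four-arm events) □ (arm event □ arm event □ ⋯)`. -/
theorem mem_tFourArm_disjointOccurrence_arms {ι κ : Type*} (t : Finset ι) (w : ι → Site 2) (r R : ι → ℕ)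
    (l : List κ) (hl : l.Nodup) (w' : κ → Site 2) (r' R' : κ → ℕ) (hrR' : ∀ i ∈ l, r' i < R' i)
    (p₁ q₁ p₂ q₂ : ι → Site 2) (c : κ → Site 2)
    (h4a : ∀ a ∈ t, triNorm (p₁ a - w a) = r a ∧ triNorm (q₁ a - w a) = R a ∧ triNorm (p₂ a - w a) = r a ∧
      triNorm (q₂ a - w a) = R a ∧ PathIn (tColourGraph ω true) (tAnn (w a) (r a) (R a)) (p₁ a) (q₁ a) ∧
      PathIn (tColourGraph ω true) (tAnn (w a) (r a) (R a)) (p₂ a) (q₂ a) ∧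
      ¬ PathIn (tColourGraph ω true) (tAnn (w a) (r a) (R a)) (p₁ a) (p₂ a))
    (harm : ∀ i ∈ l, triNorm (c i - w' i) < r' i ∧ ∃ q, (R' i : ℤ) ≤ triNorm (q - w' i) ∧
      PathIn (tColourGraph ω true) univ (c i) q)
    (hdist : ∀ i ∈ l, ∀ j ∈ l, i ≠ j → ¬ PathIn (tColourGraph ω true) univ (c i) (c j))
    (havoid : ∀ i ∈ l, ∀ a ∈ t, (¬ PathIn (tColourGraph ω true) univ (c i) (p₁ a) ∧
        ¬ PathIn (tColourGraph ω true) univ (c i) (p₂ a)) ∨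
      Disjoint (tAnn (w' i) (r' i) (R' i)) (tAnn (w a) (r a) (R a))) :
    ω ∈ (⋂ a ∈ t, TFourArmTwoClusters (w a) (r a) (R a)) □
      disjointOccurrenceList (l.map fun i ↦ {ω : SiteConfig (Site 2) | ∃ p q : Site 2, triNorm (p - w' i) = r' i ∧
        triNorm (q - w' i) = R' i ∧ PathIn (tColourGraph ω true) (tAnn (w' i) (r' i) (R' i)) p q}) := by
  classical
  -- adapted from `NeckCoarseZ2.mem_fourArm_disjointOccurrence_arms'` (`…NeckZ2NodeReimerSpatial`), sites for edges,
  -- and from `NeckCoarse.mem_disjointOccurrenceList_of_distinctClusters` (`…NeckTouchDensityT`) for the arms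
  -- open tight supports of the arms, inside the clusters of the `c i` and inside the arm annuli
  have key : ∀ i ∈ l, ∃ K : Set (Site 2), K ⊆ ω ∧
      K ∈ {ω : SiteConfig (Site 2) | ∃ p q : Site 2, triNorm (p - w' i) = r' i ∧ triNorm (q - w' i) = R' i ∧
        PathIn (tColourGraph ω true) (tAnn (w' i) (r' i) (R' i)) p q} ∧
      ∀ z ∈ K, PathIn (tColourGraph ω true) univ (c i) z ∧ z ∈ tAnn (w' i) (r' i) (R' i) := by
    intro i hi
    obtain ⟨hnear, q, hqR, hpath⟩ := harm i hi
    have hne : c i ≠ q := by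
      rintro h
      have := hrR' i hi; rw [← h] at hqR; omega
    have hcω : c i ∈ ω := by rw [tColourGraph_true] at hpath; exact NeckCoarse.mem_of_pathIn_ne hpath hne
    obtain ⟨S, hS, hP, hSt⟩ := (NeckCoarse.pathIn_inter_of_pathIn_open hpath hcω).exists_support
    obtain ⟨p, q', hp, hq', hcross⟩ := hP.exists_annulus_arm hnear.le hqR (hrR' i hi)
    obtain ⟨T, hT, hPT, -⟩ := hcross.exists_support
    refine ⟨T, fun z hz ↦ (hS (hT hz).1).2, ⟨p, q', hp, hq', ?_⟩, fun z hz ↦ ⟨?_, (hT hz).2⟩⟩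
    · exact NeckCoarse.pathIn_open_of_pathIn_inter (hPT.mono fun z hz ↦ ⟨(hT hz).2, hz⟩)
    · exact NeckCoarse.pathIn_open_of_pathIn_inter ((hSt z (hT hz).1).mono fun y hy ↦ ⟨mem_univ y, (hS hy).2⟩)
  choose! K hKω hKA hKc using key
  -- the cylinder of the four-arm events
  set K₀ : Set (Site 2) := ⋃ a ∈ t, ({z | PathIn (tColourGraph ω true) (tAnn (w a) (r a) (R a)) (p₁ a) z} ∪
    {z | PathIn (tColourGraph ω true) (tAnn (w a) (r a) (R a)) (p₂ a) z} ∪ (tAnn (w a) (r a) (R a) \ ω)) with hK₀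
  have hcyl : localCylinder K₀ ω ⊆ ⋂ a ∈ t, TFourArmTwoClusters (w a) (r a) (R a) := by
    intro ω' hω'
    refine mem_iInter₂.2 fun a ha ↦ ?_
    obtain ⟨hp₁, hq₁, hp₂, hq₂, hP₁, hP₂, hn⟩ := h4a a ha
    exact localCylinder_subset_tFourArm hp₁ hq₁ hp₂ hq₂ hP₁ hP₂ hn fun z hz ↦ hω' z (mem_biUnion ha hz)
  have hmem := mem_inter_disjointOccurrenceList_of_witnesses hcyl
    (l.map fun i ↦ ({ω : SiteConfig (Site 2) | ∃ p q : Site 2, triNorm (p - w' i) = r' i ∧ triNorm (q - w' i) = R' i ∧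
      PathIn (tColourGraph ω true) (tAnn (w' i) (r' i) (R' i)) p q}, K i))
    (fun q hq ↦ by
      obtain ⟨i, -, rfl⟩ := List.mem_map.1 hq
      exact isUpperSet_tOneArm _ _ _)
    (fun q hq ↦ by
      obtain ⟨i, hi, rfl⟩ := List.mem_map.1 hq
      exact hKA i hi)
    (fun q hq ↦ by
      obtain ⟨i, hi, rfl⟩ := List.mem_map.1 hq
      exact hKω i hi)
    ?_ ?_
  · simpa only [List.map_map, Function.comp_def] using hmem
  · -- arms in distinct clusters have site-disjoint witnesses
    rw [List.pairwise_map]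
    refine hl.pairwise_of_forall_ne fun i hi j hj hij ↦ ?_
    rw [Set.disjoint_left]
    intro z hzi hzj
    exact hdist i hi j hj hij ((hKc i hi z hzi).1.trans (hKc j hj z hzj).1.symm)
  · -- arm witnesses avoid the cylinder: they are open (not closed), and in other clusters than the crossings
    intro q hq
    obtain ⟨i, hi, rfl⟩ := List.mem_map.1 hq
    rw [hK₀, Set.disjoint_iUnion₂_left]
    intro a ha
    rw [Set.disjoint_left]
    rcases havoid i hi a ha with hcl | hsp
    · -- separated by cluster
      rintro z (⟨hz | hz⟩ | hz) hzK
      · exact hcl.1 ((hKc i hi z hzK).1.trans ((PathIn.symm hz).mono (subset_univ _)))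
      · exact hcl.2 ((hKc i hi z hzK).1.trans ((PathIn.symm hz).mono (subset_univ _)))
      · exact hz.2 (hKω i hi hzK)
    · -- separated by space
      intro z hz hzK
      have hz' : z ∈ tAnn (w a) (r a) (R a) := by
        rcases hz with (hz | hz) | hz
        · exact PathIn.right_mem hz
        · exact PathIn.right_mem hz
        · exact hz.1
      exact Set.disjoint_left.1 hsp (hKc i hi z hzK).2 hz'

/-! ## §2 The glued bound -/

/-- The annulus `tAnn` is the annulus set of `TFourArmTwoClusters` / of the one-arm event. -/
theorem tAnn_eq (w : Site 2) (r R : ℕ) : tAnn w r R = {y : Site 2 | (r : ℤ) ≤ triNorm (y - w) ∧ triNorm (y - w) ≤ R} := rfl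

end NeckCoarse

/-- **Four-arm node events over disjoint annuli AND arms of pairwise distinct clusters on `𝕋`, with spatial exemptions
(registered helper, anchor of this module on the crux item).**  GIVEN (I4T) `FourArmTwoClustersBoundT`, there are
`c, ε, C, α > 0` such that for pairwise disjoint hexagonal annuli `tAnn (w a) (r a) (R a)` (`1 ≤ r a ≤ R a`) each carrying two
open crossings not joined inside the annulus, and points `c i` (`|c i - w' i|_𝕋 < r' i`, `1 ≤ r' i < R' i`) joined by open paths
to `𝕋`-distance `≥ R' i` from `w' i`, the `c i` in pairwise DISTINCT open clusters, and for each pair (arm `i`, node `a`)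
EITHER the cluster of `c i` containing neither crossing start of `a` OR the arm annulus disjoint from the node annulus, the
probability is at most `(∏ c (r a / R a)^{1+ε}) · ∏ C (r' i / R' i)^α`. -/
theorem real_tFourArm_and_arms_le : FourArmTwoClustersBoundT → ∃ c ε C α : ℝ, 0 < ε ∧ 0 < C ∧ 0 < α ∧ ∀ (ι κ : Type) (t : Finset ι) (w : ι → Site 2) (r R : ι → ℕ) (u : Finset κ) (w' : κ → Site 2) (r' R' : κ → ℕ), (∀ a ∈ t, 1 ≤ r a ∧ r a ≤ R a) → (↑t : Set ι).PairwiseDisjoint (fun a ↦ tAnn (w a) (r a) (R a)) → (∀ i ∈ u, 1 ≤ r' i ∧ r' i < R' i) → (triSitePercolation half).real {ω | ∃ (p₁ q₁ p₂ q₂ : ι → Site 2) (c : κ → Site 2), (∀ a ∈ t, triNorm (p₁ a - w a) = r a ∧ triNorm (q₁ a - w a) = R a ∧ triNorm (p₂ a - w a) = r a ∧ triNorm (q₂ a - w a) = R a ∧ PathIn (tColourGraph ω true) (tAnn (w a) (r a) (R a)) (p₁ a) (q₁ a) ∧ PathIn (tColourGraph ω true) (tAnn (w a) (r a) (R a)) (p₂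 a) (q₂ a) ∧ ¬ PathIn (tColourGraph ω true) (tAnn (w a) (r a) (R a)) (p₁ a) (p₂ a)) ∧ (∀ i ∈ u, triNorm (c i - w' i) < r' i ∧ ∃ q, (R' i : ℤ) ≤ triNorm (q - w' i) ∧ PathIn (tColourGraph ω true) Set.univ (c i) q) ∧ (∀ i ∈ u, ∀ j ∈ u, i ≠ j → ¬ PathIn (tColourGraph ω true) Set.univ (c i) (c j)) ∧ (∀ i ∈ u, ∀ a ∈ t, (¬ PathIn (tColourGraph ω true) Set.univ (c i) (p₁ a) ∧ ¬ PathIn (tColourGraph ω true) Set.univ (c i) (p₂ a)) ∨ Disjoint (tAnn (w' i) (r' i) (R' i)) (tAnn (w a) (r a) (R a)))} ≤ (∏ a ∈ t, c * ((r a : ℝ) / R a) ^ (1 + ε)) * ∏ i ∈ u, C * ((r' i : ℝ) / (R' i : ℝ)) ^ α := by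
  intro h4T
  obtain ⟨c, ε, hε, h4⟩ := real_biInter_tFourArmTwoClusters_le_prod_rpow h4T
  obtain ⟨C, α, hC, hα, h1⟩ := NeckCoarse.real_tOneArm_le
  refine ⟨c, ε, C, α, hε, hC, hα, fun ι κ t w r R u w' r' R' hrR hdisj hrR' ↦ ?_⟩
  classical
  obtain ⟨E, hE⟩ : ∃ E : Set (SiteConfig (Site 2)), E = {ω | ∃ (p₁ q₁ p₂ q₂ : ι → Site 2) (c : κ → Site 2),
      (∀ a ∈ t, triNorm (p₁ a - w a) = r a ∧ triNorm (q₁ a - w a) = R a ∧ triNorm (p₂ a - w a) = r a ∧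
        triNorm (q₂ a - w a) = R a ∧ PathIn (tColourGraph ω true) (tAnn (w a) (r a) (R a)) (p₁ a) (q₁ a) ∧
        PathIn (tColourGraph ω true) (tAnn (w a) (r a) (R a)) (p₂ a) (q₂ a) ∧
        ¬ PathIn (tColourGraph ω true) (tAnn (w a) (r a) (R a)) (p₁ a) (p₂ a)) ∧
      (∀ i ∈ u, triNorm (c i - w' i) < r' i ∧ ∃ q, (R' i : ℤ) ≤ triNorm (q - w' i) ∧
        PathIn (tColourGraph ω true) Set.univ (c i) q) ∧
      (∀ i ∈ u, ∀ j ∈ u, i ≠ j → ¬ PathIn (tColourGraph ω true) Set.univ (c i) (c j)) ∧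
      (∀ i ∈ u, ∀ a ∈ t, (¬ PathIn (tColourGraph ω true) Set.univ (c i) (p₁ a) ∧
        ¬ PathIn (tColourGraph ω true) Set.univ (c i) (p₂ a)) ∨
        Disjoint (tAnn (w' i) (r' i) (R' i)) (tAnn (w a) (r a) (R a)))} := ⟨_, rfl⟩
  rw [← hE]
  set μ := triSitePercolation half with hμ
  set Arm : κ → Set (SiteConfig (Site 2)) := fun i ↦ {ω : SiteConfig (Site 2) | ∃ p q : Site 2,
    triNorm (p - w' i) = r' i ∧ triNorm (q - w' i) = R' i ∧
    PathIn (tColourGraph ω true) (tAnn (w' i) (r' i) (R' i)) p q} with hArm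
  set L := u.toList.map Arm with hL
  set A := ⋂ a ∈ t, TFourArmTwoClusters (w a) (r a) (R a) with hA
  -- the event implies the disjoint occurrence of `A` and the arm events
  have hcover : E ⊆ A □ disjointOccurrenceList L := by
    intro ω hω
    rw [hE] at hω
    obtain ⟨p₁, q₁, p₂, q₂, cc, h4a, harm, hdist, havoid⟩ := hω
    have h := NeckCoarse.mem_tFourArm_disjointOccurrence_arms t w r R u.toList (Finset.nodup_toList u) w' r' R'
      (fun i hi ↦ (hrR' i (Finset.mem_toList.1 hi)).2) p₁ q₁ p₂ q₂ cc h4a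
      (fun i hi ↦ harm i (Finset.mem_toList.1 hi))
      (fun i hi j hj hij ↦ hdist i (Finset.mem_toList.1 hi) j (Finset.mem_toList.1 hj) hij)
      fun i hi a ha ↦ havoid i (Finset.mem_toList.1 hi) a ha
    simpa only [hA, hL, hArm] using h
  have hup : ∀ D ∈ L, IsUpperSet D := fun D hD ↦ by
    obtain ⟨i, -, rfl⟩ := List.mem_map.1 hD
    exact NeckCoarse.isUpperSet_tOneArm _ _ _
  -- everything reads one finite set of sites
  set F : Finset (Site 2) := (t.biUnion fun a ↦ (finite_tAnnulus (w a) (r a) (R a)).toFinset) ∪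
    u.biUnion fun i ↦ (finite_tAnnulus (w' i) (r' i) (R' i)).toFinset with hF
  have hdetL : ∀ D ∈ L, DeterminedBy D ↑F := fun D hD ↦ by
    obtain ⟨i, hi, rfl⟩ := List.mem_map.1 hD
    refine (NeckCoarse.determinedBy_tOneArm (w' i) (r' i) (R' i)).mono fun y hy ↦ ?_
    rw [hF, Finset.coe_union, Finset.coe_biUnion, Finset.coe_biUnion]
    exact Or.inr (mem_biUnion (Finset.mem_coe.2 (Finset.mem_toList.1 hi)) (by simpa using hy))
  have hdetA : DeterminedBy A ↑F := by
    refine (NeckCoarse.determinedBy_biInter_tFourArmTwoClusters t w r R).mono fun y hy ↦ ?_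
    rw [hF, Finset.coe_union, Finset.coe_biUnion, Finset.coe_biUnion]
    simp only [mem_iUnion, exists_prop] at hy
    obtain ⟨a, ha, hya⟩ := hy
    exact Or.inl (mem_biUnion (Finset.mem_coe.2 ha) (by simpa using hya))
  have hdetB : DeterminedBy (disjointOccurrenceList L) ↑F := NeckCoarse.determinedBy_disjointOccurrenceList L hup hdetL
  have hreimer : μ.real (A □ disjointOccurrenceList L) ≤ μ.real A * μ.real (disjointOccurrenceList L) :=
    sitePercolation_reimer half hdetA hdetB
  have hprod : (L.map μ.real).prod = ∏ i ∈ u, μ.real (Arm i) := by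
    rw [hL, List.map_map, Function.comp_def, Finset.prod_map_toList]
  have hA4 : μ.real A ≤ ∏ a ∈ t, c * ((r a : ℝ) / R a) ^ (1 + ε) := h4 ι t w r R hrR hdisj
  have hB : μ.real (disjointOccurrenceList L) ≤ ∏ i ∈ u, C * ((r' i : ℝ) / (R' i : ℝ)) ^ α := by
    calc μ.real (disjointOccurrenceList L) ≤ (L.map μ.real).prod := NeckCoarse.sitePercolation_bk_list half L hup hdetL
      _ = ∏ i ∈ u, μ.real (Arm i) := hprod
      _ ≤ ∏ i ∈ u, C * ((r' i : ℝ) / (R' i : ℝ)) ^ α :=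
          Finset.prod_le_prod (fun i _ ↦ measureReal_nonneg) fun i hi ↦ h1 (w' i) (r' i) (R' i) (hrR' i hi).1 (hrR' i hi).2
  calc μ.real E ≤ μ.real (A □ disjointOccurrenceList L) := measureReal_mono hcover (measure_ne_top _ _)
    _ ≤ μ.real A * μ.real (disjointOccurrenceList L) := hreimer
    _ ≤ (∏ a ∈ t, c * ((r a : ℝ) / R a) ^ (1 + ε)) * ∏ i ∈ u, C * ((r' i : ℝ) / (R' i : ℝ)) ^ α :=
        mul_le_mul hA4 hB measureReal_nonneg (le_trans measureReal_nonneg hA4)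

end Summit.CriticalPhenomena.CardyFormulaZ2.Cruxes.NestingRigidity.PinchResampling

end
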